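import Literature.NumberTheory.EllipticCurves.TwoDescentOneRootKummerBridgeLocal
import Literature.NumberTheory.EllipticCurves.TwoDescentKummerBridgeRealPlace
import HarnessLib

/-!
# The one-root `2`-descent map at a real place: `x(P) − θ > 0` when `θ` is the smallest real root

The archimedean condition of the `2`-descent attached to ONE rational root `θ` (Cassels, *Lectures on
Elliptic Curves*, §15; Silverman, *AEC*, Prop. X.1.4 at `v = ∞`), one-root twin of
`TwoDescentKummerBridgeRealPlace.lean` (split `2`-torsion over `ℚ`). Over a linearly ordered field `L`, on
the curve `(x − θ)·Q(x) = (2y + a₁x + a₃)²` with `Q(x) = 4x² + (4θ + b₂)x + (4θ² + b₂θ + 2b₄)`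
(`mul_quadratic_eq_sq_of_equation`); hence `x − θ > 0` for every affine point `≠ T_θ` as soon as `Q > 0` at
`x`, which holds in the two regimes met by a real place of the `2`-division field:

* `cofactor_pos_of_Δ_neg`, `sub_pos_of_equation_of_Δ_neg` — **`Δ < 0`** (the other two roots are not
  real: `disc Q = 16·D(θ)` and `Δ = 16 c(θ)² D(θ)`, `IsTwoTorsionX.Δ_eq`), then `Q > 0` everywhere;
* `cofactor_eq_of_roots`, `sub_pos_of_equation_of_lt_roots` — **`θ < r₂`, `θ < r₃`** for the other two
  (real) roots `r₂ ≠ r₃` of `Ψ₂` (then `Q = 4(x − r₂)(x − r₃)` and three negative factors cannot multiply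
  to a square: the tree's `sub_pos_of_sq_eq_mul_mul_of_ne`);
* in both regimes `c(θ) = Q(θ)/4 > 0`, so Cassels' map `oneRootComponent θ` takes only classes of
  POSITIVE elements on `E(L)` (`exists_pos_oneRootComponent_of_Δ_neg` / `_of_lt_roots`).

Carried to `2`-Selmer classes of a number field `K` at a real place `w` (completion `K_w ≃+* ℝ`,
Mathlib `ringEquivRealOfIsReal`) through the local bridge
`exists_oneRootComponent_eq_of_mem_selmerGroup` of `TwoDescentOneRootKummerBridgeLocal.lean`:

* `pos_of_mem_selmerGroup_of_Δ_neg`, `pos_of_mem_selmerGroup_of_lt_roots` — for `c ∈ Sel⁽²⁾(E/K)` with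
  global `θ`-component `[a]`, `a ∈ Kˣ`: **`a` is positive at `w`** (in the tree's currency
  `0 < extensionEmbeddingOfIsReal hw (algebraMap K K_w a)`), when `Δ < 0` at `w`, resp. when `θ` is the
  smallest of three real roots at `w`;
* `pos_of_mem_selmerGroup_of_resTorsion_of_Δ_neg` / `_of_lt_roots` — the same for a curve over a subfield
  `k ⊂ K` and the cohomological Cassels map `Φ = kummerEquiv ∘ oneRootDescentH1` (`k = ℚ`, `K = ℚ(θ)`):
  the sign conditions of the kernel `2`-descent certificates hold for every Selmer class.

Theorems only; no named fact, no `sorry`. Seat `bsd-line-spt-p1` (g29), milestone S5(iii) of the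
`2`-Selmer upgrade of the kernel general `2`-descent.

## References

* [Cassels1991LecturesEllipticCurves] J. W. S. Cassels, *Lectures on Elliptic Curves*, LMSST 24, CUP 1991,
  §15 (the local image at infinity of `μ`).
* [SilvermanAEC2009] J. H. Silverman, *The Arithmetic of Elliptic Curves*, 2nd ed., GTM 106, Springer 2009,
  Prop. X.1.4 (the place `v = ∞` of `S`), Prop. X.4.9, Example X.4.10.
-/

noncomputable section

open scoped Classical

/-! ### Ordered fields: the cofactor `Q` and the sign of `x − θ` -/

namespace WeierstrassCurve.Affine

variable {L : Type*} [Field L] [LinearOrder L] [IsStrictOrderedRing L] {W : Affine L} {θ : L}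

/-- A quadratic with positive leading coefficient and negative discriminant is positive:
`4α(αt² + βt + γ) = (2αt + β)² − (β² − 4αγ)`. [folklore] -/
private theorem quadratic_pos_of_discrim_neg {α β γ : L} (hα : 0 < α) (hd : β ^ 2 - 4 * α * γ < 0) (t : L) :
    0 < α * t ^ 2 + β * t + γ := by
  have h4 : 0 < 4 * α * (α * t ^ 2 + β * t + γ) := by
    have hsq : 0 ≤ (2 * α * t + β) ^ 2 := sq_nonneg _
    nlinarith
  have h4α : 0 < 4 * α := by positivity
  exact pos_of_mul_pos_right h4 h4α.le

/-- The discriminant of the cofactor `Q(x) = 4x² + (4θ + b₂)x + (4θ² + b₂θ + 2b₄)` of `x − θ` in `Ψ₂` is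
`16·D(θ)`, `D(θ) = b₂²/16 − 2b₄ − (b₂/2)θ − 3θ²` the second factor of `Δ = 16 c(θ)² D(θ)`.
[cite: SilvermanAEC2009, §III.1 (Δ and the 2-division polynomial)] -/
theorem cofactor_discrim_eq (θ : L) :
    (4 * θ + W.b₂) ^ 2 - 4 * 4 * (4 * θ ^ 2 + W.b₂ * θ + 2 * W.b₄) =
      16 * (W.b₂ ^ 2 / 16 - 2 * W.b₄ - W.b₂ / 2 * θ - 3 * θ ^ 2) := by
  field_simp
  ring

/-- **`Δ < 0` ⇒ the cofactor is positive definite**: with one real root `θ` and `Δ = 16 c(θ)² D(θ) < 0`,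
`D(θ) < 0`, so `Q(t) = 4t² + (4θ + b₂)t + (4θ² + b₂θ + 2b₄) > 0` for all `t` (the other two roots of `Ψ₂`
are not in `L`). [cite: SilvermanAEC2009, Prop. X.1.4 (v = ∞)] -/
theorem cofactor_pos_of_Δ_neg (h : W.IsTwoTorsionX θ) (hΔ : W.Δ < 0) (t : L) :
    0 < 4 * t ^ 2 + (4 * θ + W.b₂) * t + (4 * θ ^ 2 + W.b₂ * θ + 2 * W.b₄) := by
  have hD : W.b₂ ^ 2 / 16 - 2 * W.b₄ - W.b₂ / 2 * θ - 3 * θ ^ 2 < 0 := by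
    rw [h.Δ_eq] at hΔ
    have hc2 : 0 ≤ 16 * W.oneRootConst θ ^ 2 := by positivity
    by_contra hle
    have hge : 0 ≤ W.b₂ ^ 2 / 16 - 2 * W.b₄ - W.b₂ / 2 * θ - 3 * θ ^ 2 := not_lt.mp hle
    exact absurd hΔ (not_lt.mpr (mul_nonneg hc2 hge))
  refine quadratic_pos_of_discrim_neg (by norm_num) ?_ t
  rw [cofactor_discrim_eq]
  linarith

/-- **`x − θ > 0` on real points when `Δ < 0`**: for `(x, y)` on the curve with `x ≠ θ`,
`(x − θ)·Q(x) = (2y + a₁x + a₃)² ≥ 0` and `Q(x) > 0`. [cite: SilvermanAEC2009, Prop. X.1.4 (v = ∞)]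
[cite: Cassels1991LecturesEllipticCurves, §15] -/
theorem sub_pos_of_equation_of_Δ_neg (h : W.IsTwoTorsionX θ) (hΔ : W.Δ < 0) {x y : L}
    (hxy : W.Equation x y) (hx : x ≠ θ) : 0 < x - θ := by
  have key := mul_quadratic_eq_sq_of_equation h hxy
  have hQ := cofactor_pos_of_Δ_neg h hΔ x
  have hsq : 0 ≤ (x - θ) * (4 * x ^ 2 + (4 * θ + W.b₂) * x + (4 * θ ^ 2 + W.b₂ * θ + 2 * W.b₄)) := by
    rw [key]; exact sq_nonneg _
  rcases lt_or_gt_of_ne (sub_ne_zero.mpr hx) with hlt | hgt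
  · exact absurd hsq (not_le.mpr (mul_neg_of_neg_of_pos hlt hQ))
  · exact hgt

/-- `c(θ) = Q(θ)/4 > 0` when `Δ < 0`. [cite: Cassels1991LecturesEllipticCurves, §15 (iii)] -/
theorem oneRootConst_pos_of_Δ_neg (h : W.IsTwoTorsionX θ) (hΔ : W.Δ < 0) : 0 < W.oneRootConst θ := by
  have hQ := cofactor_pos_of_Δ_neg h hΔ θ
  have hc : 4 * θ ^ 2 + (4 * θ + W.b₂) * θ + (4 * θ ^ 2 + W.b₂ * θ + 2 * W.b₄) = 4 * W.oneRootConst θ := by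
    unfold oneRootConst; field_simp; ring
  rw [hc] at hQ
  linarith

/-- **Cassels' map is positive on `E(L)` when `Δ < 0`**: every value `oneRootComponent θ P` is the class
of a positive element (`O ↦ 1`, `T_θ ↦ c(θ) > 0`, `(x, y) ↦ x − θ > 0`).
[cite: Cassels1991LecturesEllipticCurves, §15] [cite: SilvermanAEC2009, Prop. X.1.4 (v = ∞)] -/
theorem exists_pos_oneRootComponent_of_Δ_neg (h : W.IsTwoTorsionX θ) (hΔ : W.Δ < 0) (P : W.Point) :
    ∃ r : L, 0 < r ∧ Point.oneRootComponent W θ P = sqClass r := by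
  rcases P with _ | ⟨x, y, hP⟩
  · refine ⟨1, one_pos, ?_⟩
    rw [← Point.zero_def, Point.oneRootComponent_zero]
    exact ((sqClass_eq_one_iff one_ne_zero).mpr ⟨1, by ring⟩).symm
  · by_cases hx : x = θ
    · exact ⟨W.oneRootConst θ, oneRootConst_pos_of_Δ_neg h hΔ, Point.oneRootComponent_some_of_eq hP hx⟩
    · exact ⟨x - θ, sub_pos_of_equation_of_Δ_neg h hΔ hP.1 hx, Point.oneRootComponent_some_of_ne hP hx⟩

/-- **The cofactor splits at the other two roots**: if `r₂ ≠ r₃` are roots of `Ψ₂` different from `θ`, then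
`Q(t) = 4(t − r₂)(t − r₃)` identically (a quadratic is determined by two roots and its leading term).
[cite: SilvermanAEC2009, Prop. X.1.4] -/
theorem cofactor_eq_of_roots (h : W.IsTwoTorsionX θ) {r₂ r₃ : L} (h₂ : W.IsTwoTorsionX r₂)
    (h₃ : W.IsTwoTorsionX r₃) (h2θ : r₂ ≠ θ) (h3θ : r₃ ≠ θ) (h23 : r₂ ≠ r₃) (t : L) :
    4 * t ^ 2 + (4 * θ + W.b₂) * t + (4 * θ ^ 2 + W.b₂ * θ + 2 * W.b₄) = 4 * (t - r₂) * (t - r₃) := by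
  -- `Ψ₂(X) = (X − θ)·Q(X)` as polynomials, so `Q(rᵢ) = 0`
  have hfac : ∀ s : L, 4 * s ^ 3 + W.b₂ * s ^ 2 + 2 * W.b₄ * s + W.b₆ =
      (s - θ) * (4 * s ^ 2 + (4 * θ + W.b₂) * s + (4 * θ ^ 2 + W.b₂ * θ + 2 * W.b₄)) := by
    intro s
    linear_combination h.eq
  have hQ₂ : 4 * r₂ ^ 2 + (4 * θ + W.b₂) * r₂ + (4 * θ ^ 2 + W.b₂ * θ + 2 * W.b₄) = 0 := by
    have := hfac r₂
    rw [h₂.eq] at this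
    exact (mul_eq_zero.mp this.symm).resolve_left (sub_ne_zero.mpr h2θ)
  have hQ₃ : 4 * r₃ ^ 2 + (4 * θ + W.b₂) * r₃ + (4 * θ ^ 2 + W.b₂ * θ + 2 * W.b₄) = 0 := by
    have := hfac r₃
    rw [h₃.eq] at this
    exact (mul_eq_zero.mp this.symm).resolve_left (sub_ne_zero.mpr h3θ)
  -- the difference `Q(t) − 4(t − r₂)(t − r₃)` is linear in `t` with the two roots `r₂ ≠ r₃`
  have hlin : (4 * θ + W.b₂ + 4 * (r₂ + r₃)) * r₂ + (4 * θ ^ 2 + W.b₂ * θ + 2 * W.b₄ - 4 * r₂ * r₃) = 0 := by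
    linear_combination hQ₂
  have hlin' : (4 * θ + W.b₂ + 4 * (r₂ + r₃)) * r₃ + (4 * θ ^ 2 + W.b₂ * θ + 2 * W.b₄ - 4 * r₂ * r₃) = 0 := by
    linear_combination hQ₃
  have hA : 4 * θ + W.b₂ + 4 * (r₂ + r₃) = 0 := by
    have hsub : (4 * θ + W.b₂ + 4 * (r₂ + r₃)) * (r₂ - r₃) = 0 := by linear_combination hlin - hlin'
    exact (mul_eq_zero.mp hsub).resolve_right (sub_ne_zero.mpr h23)
  have hB : 4 * θ ^ 2 + W.b₂ * θ + 2 * W.b₄ - 4 * r₂ * r₃ = 0 := by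
    rw [hA, zero_mul, zero_add] at hlin
    exact hlin
  linear_combination t * hA + hB

/-- **`x − θ > 0` on real points when `θ` is the smallest root**: if the other two roots `r₂ ≠ r₃` of `Ψ₂`
lie in `L` with `θ < r₂`, `θ < r₃`, then every `(x, y)` on the curve with `x ≠ θ` has `x > θ` (three negative
factors cannot multiply to a square). [cite: SilvermanAEC2009, Prop. X.1.4 (v = ∞)]
[cite: Cassels1991LecturesEllipticCurves, §15] -/
theorem sub_pos_of_equation_of_lt_roots (h : W.IsTwoTorsionX θ) {r₂ r₃ : L} (h₂ : W.IsTwoTorsionX r₂)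
    (h₃ : W.IsTwoTorsionX r₃) (hθ₂ : θ < r₂) (hθ₃ : θ < r₃) (h23 : r₂ ≠ r₃) {x y : L}
    (hxy : W.Equation x y) (hx : x ≠ θ) : 0 < x - θ := by
  have key := mul_quadratic_eq_sq_of_equation h hxy
  rw [cofactor_eq_of_roots h h₂ h₃ hθ₂.ne' hθ₃.ne' h23 x] at key
  have hsq : ((2 * y + W.a₁ * x + W.a₃) / 2) ^ 2 = (x - θ) * (x - r₂) * (x - r₃) := by
    linear_combination (-(1 : L) / 4) * key
  exact Literature.NumberTheory.EllipticCurves.TwoDescentLocal.sub_pos_of_sq_eq_mul_mul_of_ne hθ₂ hθ₃ hx hsq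

/-- `c(θ) = (θ − r₂)(θ − r₃) > 0` when `θ` is the smallest root. [cite: Cassels1991LecturesEllipticCurves, §15 (iii)] -/
theorem oneRootConst_pos_of_lt_roots (h : W.IsTwoTorsionX θ) {r₂ r₃ : L} (h₂ : W.IsTwoTorsionX r₂)
    (h₃ : W.IsTwoTorsionX r₃) (hθ₂ : θ < r₂) (hθ₃ : θ < r₃) (h23 : r₂ ≠ r₃) : 0 < W.oneRootConst θ := by
  have hQ := cofactor_eq_of_roots h h₂ h₃ hθ₂.ne' hθ₃.ne' h23 θ
  have hc : W.oneRootConst θ = (θ - r₂) * (θ - r₃) := by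
    have : 4 * θ ^ 2 + (4 * θ + W.b₂) * θ + (4 * θ ^ 2 + W.b₂ * θ + 2 * W.b₄) = 4 * W.oneRootConst θ := by
      unfold oneRootConst; field_simp; ring
    linear_combination (hQ - this) / 4
  rw [hc]
  exact mul_pos_of_neg_of_neg (sub_neg.mpr hθ₂) (sub_neg.mpr hθ₃)

/-- **Cassels' map is positive on `E(L)` when `θ` is the smallest root.**
[cite: Cassels1991LecturesEllipticCurves, §15] [cite: SilvermanAEC2009, Prop. X.1.4 (v = ∞)] -/
theorem exists_pos_oneRootComponent_of_lt_roots (h : W.IsTwoTorsionX θ) {r₂ r₃ : L}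
    (h₂ : W.IsTwoTorsionX r₂) (h₃ : W.IsTwoTorsionX r₃) (hθ₂ : θ < r₂) (hθ₃ : θ < r₃) (h23 : r₂ ≠ r₃)
    (P : W.Point) : ∃ r : L, 0 < r ∧ Point.oneRootComponent W θ P = sqClass r := by
  rcases P with _ | ⟨x, y, hP⟩
  · refine ⟨1, one_pos, ?_⟩
    rw [← Point.zero_def, Point.oneRootComponent_zero]
    exact ((sqClass_eq_one_iff one_ne_zero).mpr ⟨1, by ring⟩).symm
  · by_cases hx : x = θ
    · exact ⟨W.oneRootConst θ, oneRootConst_pos_of_lt_roots h h₂ h₃ hθ₂ hθ₃ h23,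
        Point.oneRootComponent_some_of_eq hP hx⟩
    · exact ⟨x - θ, sub_pos_of_equation_of_lt_roots h h₂ h₃ hθ₂ hθ₃ h23 hP.1 hx,
        Point.oneRootComponent_some_of_ne hP hx⟩

/-- **A square class with a positive representative is positive**: `[u] = sqClass r`, `0 < r` ⇒ `0 < u`
(`r = u s²`). [cite: SilvermanAEC2009, X.§1 (Example X.1.5)] -/
theorem pos_of_mk_eq_sqClass {u : Lˣ} {r : L} (hr : 0 < r)
    (h : (QuotientGroup.mk u : SqUnits L) = sqClass r) : 0 < (u : L) := by
  obtain ⟨s, hs0, hrs⟩ :=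
    Literature.NumberTheory.EllipticCurves.TwoDescentLocal.exists_eq_mul_sq_of_mk_eq_sqClass hr.ne' h
  have hs2 : 0 < s ^ 2 := by positivity
  rw [hrs] at hr
  exact pos_of_mul_pos_left hr hs2.le

end WeierstrassCurve.Affine

/-! ### Transport along a ring isomorphism onto an ordered field (`K_w ≃+* ℝ`) -/

namespace WeierstrassCurve

open Literature.NumberTheory.GaloisRepresentations Literature.NumberTheory.EllipticCurves Field
open WeierstrassCurve.Affine NumberField

universe u

variable {K : Type u} [Field K] [CharZero K] (W : WeierstrassCurve K) [W.IsElliptic] {θ : K}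
variable (E : Type u) [Field E] [Algebra K E] [CharZero E]

omit [CharZero K] [W.IsElliptic] [CharZero E] in
/-- `IsTwoTorsionX` along a ring homomorphism: a root of `Ψ₂` of `W` maps to a root of `Ψ₂` of `W.map f`.
[cite: SilvermanAEC2009, Prop. III.2.3] -/
theorem isTwoTorsionX_map {R : Type*} [Field R] (f : E →+* R) {V : WeierstrassCurve E} {t : E}
    (ht : V.toAffine.IsTwoTorsionX t) : (V.map f).toAffine.IsTwoTorsionX (f t) := by
  refine ⟨?_⟩
  have h' := congrArg f ht.eq
  simp only [map_add, map_mul, map_pow, map_ofNat, map_zero] at h'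
  rw [map_b₂, map_b₄, map_b₆]
  exact h'

omit [CharZero K] [W.IsElliptic] in
/-- **Positivity of the one-root component, read through `φ : E ≃+* R` into an ordered field**: if for
every point of the curve transported to `R` the component (at the root `φ(ι θ)`) is the class of a positive
element, then a point `P ∈ (W⁄E)(E)` whose component is `[ι a]`, `a ∈ Kˣ`, has `0 < φ(ι a)`. Technical core
shared by the two regimes (`Δ < 0`; smallest root). [cite: SilvermanAEC2009, Prop. X.1.4 (v = ∞)] -/
theorem pos_map_of_oneRootComponent_eq {R : Type*} [Field R] [LinearOrder R] [IsStrictOrderedRing R]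
    (h : W.toAffine.IsTwoTorsionX θ) [(W.baseChange E).IsElliptic] (φ : E ≃+* R)
    (hpos : ∀ P : ((W.baseChange E).map φ.toRingHom).toAffine.Point, ∃ r : R, 0 < r ∧
      Affine.Point.oneRootComponent ((W.baseChange E).map φ.toRingHom).toAffine (φ (algebraMap K E θ)) P =
        sqClass r)
    (P : (W.baseChange E).toAffine.Point) (a : Kˣ)
    (hP : Affine.Point.oneRootComponent (W.baseChange E).toAffine (algebraMap K E θ) P =
      QuotientGroup.mk (Units.map (algebraMap K E : K →* E) a)) :
    0 < φ (algebraMap K E (a : K)) := by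
  have hsq : ∀ {s : E}, s ≠ 0 → 0 < φ s ^ 2 := fun {s} hs0 => by
    have : φ s ≠ 0 := (map_ne_zero_iff φ φ.injective).mpr hs0
    positivity
  rcases P with _ | ⟨x, y, hxy⟩
  · -- `P = O`: `[ι a] = 1`, so `1 = ι a · s²` and `φ(ι a) = 1/φ(s)² > 0`
    rw [← Affine.Point.zero_def, Affine.Point.oneRootComponent_zero] at hP
    have h1 : (QuotientGroup.mk (Units.map (algebraMap K E : K →* E) a) : SqUnits E) = sqClass 1 :=
      hP.symm.trans ((sqClass_eq_one_iff one_ne_zero).mpr ⟨1, by ring⟩).symm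
    obtain ⟨s, hs0, hs⟩ := TwoDescentLocal.exists_eq_mul_sq_of_mk_eq_sqClass one_ne_zero h1
    rw [Units.coe_map, MonoidHom.coe_coe] at hs
    have hprod : 0 < φ (algebraMap K E (a : K)) * φ s ^ 2 := by
      rw [← map_pow, ← map_mul, ← hs, map_one]; exact one_pos
    exact pos_of_mul_pos_left hprod (hsq hs0).le
  · -- an affine point: transport it to `R` and use `hpos` there
    have hxy' : ((W.baseChange E).map φ.toRingHom).toAffine.Nonsingular (φ x) (φ y) :=
      (Affine.map_nonsingular (W := (W.baseChange E).toAffine) (f := φ.toRingHom) φ.injective x y).mpr hxy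
    obtain ⟨r, hr, hPr⟩ := hpos (Affine.Point.some (φ x) (φ y) hxy')
    by_cases hx : x = algebraMap K E θ
    · -- `P = T_θ`: components `c(θ)` and `φ(c(θ))`
      rw [Affine.Point.oneRootComponent_some_of_eq hxy hx] at hP
      have hx' : φ x = φ (algebraMap K E θ) := by rw [hx]
      rw [Affine.Point.oneRootComponent_some_of_eq hxy' hx'] at hPr
      have hc : ((W.baseChange E).map φ.toRingHom).toAffine.oneRootConst (φ (algebraMap K E θ)) =
          φ ((W.baseChange E).toAffine.oneRootConst (algebraMap K E θ)) := by
        simp only [Affine.oneRootConst, map_b₂, map_b₄, map_add, map_mul, map_div₀, map_pow, map_ofNat,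
          RingEquiv.toRingHom_eq_coe, RingHom.coe_coe]
      have hc0 : (W.baseChange E).toAffine.oneRootConst (algebraMap K E θ) ≠ 0 :=
        (W.isTwoTorsionX_baseChange h E).oneRootConst_ne_zero
      have hc0' : φ ((W.baseChange E).toAffine.oneRootConst (algebraMap K E θ)) ≠ 0 :=
        (map_ne_zero_iff φ φ.injective).mpr hc0
      rw [hc, sqClass_of_ne_zero hc0'] at hPr
      have hcpos : 0 < φ ((W.baseChange E).toAffine.oneRootConst (algebraMap K E θ)) := by
        have := pos_of_mk_eq_sqClass hr hPr
        rwa [Units.val_mk0] at this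
      obtain ⟨s, hs0, hs⟩ := TwoDescentLocal.exists_eq_mul_sq_of_mk_eq_sqClass hc0 hP.symm
      rw [Units.coe_map, MonoidHom.coe_coe] at hs
      rw [hs, map_mul, map_pow] at hcpos
      exact pos_of_mul_pos_left hcpos (hsq hs0).le
    · -- generic point: components `x − θ` and `φ(x) − φ(θ) = φ(x − θ)`
      rw [Affine.Point.oneRootComponent_some_of_ne hxy hx] at hP
      have hx' : φ x ≠ φ (algebraMap K E θ) := fun h' => hx (φ.injective h')
      rw [Affine.Point.oneRootComponent_some_of_ne hxy' hx', sqClass_of_ne_zero (sub_ne_zero.mpr hx')] at hPr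
      have hdpos : 0 < φ x - φ (algebraMap K E θ) := by
        have := pos_of_mk_eq_sqClass hr hPr
        rwa [Units.val_mk0] at this
      obtain ⟨s, hs0, hs⟩ := TwoDescentLocal.exists_eq_mul_sq_of_mk_eq_sqClass (sub_ne_zero.mpr hx) hP.symm
      rw [Units.coe_map, MonoidHom.coe_coe] at hs
      rw [← map_sub, hs, map_mul, map_pow] at hdpos
      exact pos_of_mul_pos_left hdpos (hsq hs0).le

/-! ### Selmer classes of a number field at a real place -/

/-- **Selmer classes are positive at a real place where `Δ < 0`** (one rational root; Cassels §15 /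
Silverman AEC X.1.4 at `v = ∞`): `K` a number field, `w` a real place with `Δ` negative at `w`,
`c ∈ Sel⁽²⁾(E/K)` with global `θ`-component `[a]`, `a ∈ Kˣ`; then `a` is positive at `w`.
[cite: Cassels1991LecturesEllipticCurves, §15] [cite: SilvermanAEC2009, Prop. X.1.4, Prop. X.4.9] -/
theorem pos_of_mem_selmerGroup_of_Δ_neg [NumberField K] (h : W.toAffine.IsTwoTorsionX θ)
    {c : galH1Torsion W 2} (hc : c ∈ selmerGroup W 2) (w : InfinitePlace K) (hw : w.IsReal)
    (hΔ : InfinitePlace.Completion.extensionEmbeddingOfIsReal hw (algebraMap K w.Completion W.Δ) < 0)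
    (a : Kˣ) (ha : kummerEquiv K 2 (W.oneRootCharH1 h c) = Additive.ofMul (QuotientGroup.mk a)) :
    0 < InfinitePlace.Completion.extensionEmbeddingOfIsReal hw (algebraMap K w.Completion (a : K)) := by
  haveI : CharZero w.Completion := charZero_of_injective_algebraMap (algebraMap K w.Completion).injective
  haveI : (W.baseChange w.Completion).IsElliptic := W.isElliptic_baseChange _
  haveI : (W.baseChange (Place.Completion (Sum.inl w : Place K))).IsElliptic := W.isElliptic_baseChange _
  haveI : CharZero (Place.Completion (Sum.inl w : Place K)) :=
    charZero_of_injective_algebraMap (algebraMap K w.Completion).injective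
  obtain ⟨P, hP⟩ := W.exists_oneRootComponent_eq_of_mem_selmerGroup h hc (Sum.inl w : Place K) a ha
  -- every point of the curve over `ℝ` (via `φ ∘ ι`, `φ : K_w ≃+* ℝ`) has a positive component: regime `Δ < 0`
  have hθ' := isTwoTorsionX_map w.Completion (InfinitePlace.Completion.ringEquivRealOfIsReal hw).toRingHom
    (W.isTwoTorsionX_baseChange h w.Completion)
  have hΔ' : ((W.baseChange w.Completion).map
      (InfinitePlace.Completion.ringEquivRealOfIsReal hw).toRingHom).toAffine.Δ < 0 := by
    have : ((W.baseChange w.Completion).map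
        (InfinitePlace.Completion.ringEquivRealOfIsReal hw).toRingHom).toAffine.Δ =
        InfinitePlace.Completion.ringEquivRealOfIsReal hw (algebraMap K w.Completion W.Δ) := by
      rw [show ((W.baseChange w.Completion).map
        (InfinitePlace.Completion.ringEquivRealOfIsReal hw).toRingHom).toAffine.Δ =
        ((W.baseChange w.Completion).map (InfinitePlace.Completion.ringEquivRealOfIsReal hw).toRingHom).Δ
        from rfl, map_Δ]
      simp only [baseChange, map_Δ, RingEquiv.toRingHom_eq_coe, RingHom.coe_coe]
    rw [this]
    exact hΔ
  exact W.pos_map_of_oneRootComponent_eq w.Completion h (InfinitePlace.Completion.ringEquivRealOfIsReal hw)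
    (fun P' => exists_pos_oneRootComponent_of_Δ_neg hθ' hΔ' P') P a hP

/-- **Selmer classes are positive at a real place where `θ` is the smallest root** (one rational root;
three real roots `θ < r₂`, `θ < r₃` at `w`): for `c ∈ Sel⁽²⁾(E/K)` with global `θ`-component `[a]`, `a` is
positive at `w`. [cite: Cassels1991LecturesEllipticCurves, §15] [cite: SilvermanAEC2009, Prop. X.1.4, Prop. X.4.9] -/
theorem pos_of_mem_selmerGroup_of_lt_roots [NumberField K] (h : W.toAffine.IsTwoTorsionX θ)
    {c : galH1Torsion W 2} (hc : c ∈ selmerGroup W 2) (w : InfinitePlace K) (hw : w.IsReal) {r₂ r₃ : ℝ}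
    (h₂ : ((W.baseChange w.Completion).map
      (InfinitePlace.Completion.ringEquivRealOfIsReal hw).toRingHom).toAffine.IsTwoTorsionX r₂)
    (h₃ : ((W.baseChange w.Completion).map
      (InfinitePlace.Completion.ringEquivRealOfIsReal hw).toRingHom).toAffine.IsTwoTorsionX r₃)
    (hθ₂ : InfinitePlace.Completion.extensionEmbeddingOfIsReal hw (algebraMap K w.Completion θ) < r₂)
    (hθ₃ : InfinitePlace.Completion.extensionEmbeddingOfIsReal hw (algebraMap K w.Completion θ) < r₃)
    (h23 : r₂ ≠ r₃)
    (a : Kˣ) (ha : kummerEquiv K 2 (W.oneRootCharH1 h c) = Additive.ofMul (QuotientGroup.mk a)) :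
    0 < InfinitePlace.Completion.extensionEmbeddingOfIsReal hw (algebraMap K w.Completion (a : K)) := by
  haveI : CharZero w.Completion := charZero_of_injective_algebraMap (algebraMap K w.Completion).injective
  haveI : (W.baseChange w.Completion).IsElliptic := W.isElliptic_baseChange _
  haveI : (W.baseChange (Place.Completion (Sum.inl w : Place K))).IsElliptic := W.isElliptic_baseChange _
  haveI : CharZero (Place.Completion (Sum.inl w : Place K)) :=
    charZero_of_injective_algebraMap (algebraMap K w.Completion).injective
  obtain ⟨P, hP⟩ := W.exists_oneRootComponent_eq_of_mem_selmerGroup h hc (Sum.inl w : Place K) a ha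
  have hθ' := isTwoTorsionX_map w.Completion (InfinitePlace.Completion.ringEquivRealOfIsReal hw).toRingHom
    (W.isTwoTorsionX_baseChange h w.Completion)
  exact W.pos_map_of_oneRootComponent_eq w.Completion h (InfinitePlace.Completion.ringEquivRealOfIsReal hw)
    (fun P' => exists_pos_oneRootComponent_of_lt_roots hθ' h₂ h₃ hθ₂ hθ₃ h23 P') P a hP

/-! ### A curve over a subfield: the cohomological Cassels map `Φ = kummerEquiv ∘ oneRootDescentH1` -/

/-- **Sign condition for `Φ(Sel⁽²⁾(E/k))` at a real place of the root field with `Δ < 0`** (`k = ℚ`,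
`K = ℚ(θ)` complex cubic: its unique real place): for `c ∈ Sel⁽²⁾(E/k)` with `Φ(c) = [a]`, `a ∈ Kˣ`, `a` is
positive at `w`. [cite: Cassels1991LecturesEllipticCurves, §15] [cite: SilvermanAEC2009, Prop. X.1.4] -/
theorem pos_of_mem_selmerGroup_of_resTorsion_of_Δ_neg
    {k : Type u} [Field k] [NumberField k] (V : WeierstrassCurve k) [V.IsElliptic]
    [Algebra k K] [NumberField K] [(V.baseChange K).IsElliptic]
    (hθ : (V.baseChange K).toAffine.IsTwoTorsionX θ) {c : galH1Torsion V 2} (hc : c ∈ selmerGroup V 2)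
    (w : InfinitePlace K) (hw : w.IsReal)
    (hΔ : InfinitePlace.Completion.extensionEmbeddingOfIsReal hw (algebraMap K w.Completion (V.baseChange K).Δ) < 0)
    (a : Kˣ) (ha : kummerEquiv K 2 (V.oneRootDescentH1 K hθ c) = Additive.ofMul (QuotientGroup.mk a)) :
    0 < InfinitePlace.Completion.extensionEmbeddingOfIsReal hw (algebraMap K w.Completion (a : K)) := by
  rw [oneRootDescentH1_apply] at ha
  exact (V.baseChange K).pos_of_mem_selmerGroup_of_Δ_neg hθ (resTorsion_mem_selmerGroup V K 2 hc) w hw hΔ a ha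

/-- **Sign condition for `Φ(Sel⁽²⁾(E/k))` at the real place of the root field where `θ` is the smallest root**
(`k = ℚ`, `K = ℚ(θ)` totally real cubic, place `ρ₁`): for `c ∈ Sel⁽²⁾(E/k)` with `Φ(c) = [a]`, `a` is
positive at `w`. [cite: Cassels1991LecturesEllipticCurves, §15] [cite: SilvermanAEC2009, Prop. X.1.4] -/
theorem pos_of_mem_selmerGroup_of_resTorsion_of_lt_roots
    {k : Type u} [Field k] [NumberField k] (V : WeierstrassCurve k) [V.IsElliptic]
    [Algebra k K] [NumberField K] [(V.baseChange K).IsElliptic]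
    (hθ : (V.baseChange K).toAffine.IsTwoTorsionX θ) {c : galH1Torsion V 2} (hc : c ∈ selmerGroup V 2)
    (w : InfinitePlace K) (hw : w.IsReal) {r₂ r₃ : ℝ}
    (h₂ : (((V.baseChange K).baseChange w.Completion).map
      (InfinitePlace.Completion.ringEquivRealOfIsReal hw).toRingHom).toAffine.IsTwoTorsionX r₂)
    (h₃ : (((V.baseChange K).baseChange w.Completion).map
      (InfinitePlace.Completion.ringEquivRealOfIsReal hw).toRingHom).toAffine.IsTwoTorsionX r₃)
    (hθ₂ : InfinitePlace.Completion.extensionEmbeddingOfIsReal hw (algebraMap K w.Completion θ) < r₂)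
    (hθ₃ : InfinitePlace.Completion.extensionEmbeddingOfIsReal hw (algebraMap K w.Completion θ) < r₃)
    (h23 : r₂ ≠ r₃)
    (a : Kˣ) (ha : kummerEquiv K 2 (V.oneRootDescentH1 K hθ c) = Additive.ofMul (QuotientGroup.mk a)) :
    0 < InfinitePlace.Completion.extensionEmbeddingOfIsReal hw (algebraMap K w.Completion (a : K)) := by
  rw [oneRootDescentH1_apply] at ha
  exact (V.baseChange K).pos_of_mem_selmerGroup_of_lt_roots hθ (resTorsion_mem_selmerGroup V K 2 hc) w hw
    h₂ h₃ hθ₂ hθ₃ h23 a ha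

end WeierstrassCurve

end
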